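import Summits.NavierStokesRegularity.FunctionalMining.NoGo.SpiralJetField
import Literature.Analysis.FluidPDE.TorusVorticityTensorTransport
import Literature.Analysis.FluidPDE.ExtremeGrowthVorticityControl
import HarnessLib

/-!
# K1-Q2 all-`q` kill-all, part 3: the weighted stretching of the spiral-jet field, pointwise

Search for candidate a priori estimates; no regularity claim. NS FUNCTIONAL MINING — NO-GO BRANCH
(cell `pub-nsfunc`, prove seat gen 13). For the spiral-jet witness `sfld` (part 2), in cube
coordinates (`p = pc`, `q = qc`, `s = rs`, `V = Vz(y₂)`, `V′ = dVz(y₂)`, jet gradient `J2x, J2y`):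

* `vortSq_eq_core` / `stretching_eq` — in the core `s ≤ 3/16`,
  `|ω|² = A0 + 2·X1 + X2` with `A0 = sV′² + 4V²`, `X1 = V′(q J2x − p J2y)`, `X2 = J2x² + J2y²`, and
  EVERYWHERE `σ = S1 := −4VV′(p J2x + q J2y)` (outside the core the jet gradient vanishes and the
  cut-off swirl has `σ ≡ 0` identically); hence `(|ω|²)^r σ = (A0 + 2X1 + X2)^r S1` (`moment_density_eq`);
* sums of squares `A0 + X2 ± 2X1 = 4V² + (J2x ± qV′)² + (J2y ∓ pV′)² ≥ 0`;
* the decomposition `S1 = Scoll + 8·V·s·ψf′(s)·X1` (`S1_eq`), `Scoll = −4VV′(kf + 2s·kf′)(p cf − q df)`,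
  with `X1 = V′·kf·(p df + q cf)` (`X1_eq`);
* the coordinate reflections `reflT k ξ` (negate the `k`-th angle) read through `repr`:
  `y₂ ↦ fract(−y₂)` leaves `p, q, s, V` and flips `V′` (`A0, X2` even, `X1, S1` odd: `reflT 2`);
  `y₀ ↦ fract(−y₀)` gives `p ↦ −p` off the face (and on the face everything relevant vanishes), under
  which `Scoll`-weighted brackets are ODD (`Gcoll_reflT_zero`, via the collar/plateau dichotomy of
  part 1: where `Bf′(s) ≠ 0` the twist is locked, `df = 0`, `ψf′ = 0`).
Pure pointwise algebra (`ring` on the closed-form Jacobian); nothing about Navier–Stokes is asserted.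
-/

noncomputable section

open MeasureTheory Set Function Filter Topology Metric
open scoped ContDiff Real

namespace Summit.NavierStokesRegularity.FunctionalMining

namespace SpiralJet

open Literature.Analysis.FunctionSpaces Literature.Analysis.FunctionSpaces.Torus
  Literature.Analysis.FluidPDE KillAll

/-! ## The four densities -/

/-- `A0 = s·V′² + 4V²` (the jet-free part of `|ω|²` in the core). [ours] -/
def A0 (y : E3) : ℝ := rs y * dVz (y 2) ^ 2 + 4 * Vz (y 2) ^ 2

/-- `X1 = V′ (q·J2x − p·J2y)` (the cross term, odd in `z ↦ 1 − z`). [ours] -/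
def X1 (y : E3) : ℝ := dVz (y 2) * (qc y * J2x y - pc y * J2y y)

/-- `X2 = J2x² + J2y²` (the jet's own gradient energy). [ours] -/
def X2 (y : E3) : ℝ := J2x y ^ 2 + J2y y ^ 2

/-- `S1 = −4 V V′ (p·J2x + q·J2y)` (the stretching density of the spiral-jet field). [ours] -/
def S1 (y : E3) : ℝ := -4 * Vz (y 2) * dVz (y 2) * (pc y * J2x y + qc y * J2y y)

/-- The COLLAR part of `S1`: `Scoll = −4VV′(kf(s) + 2s·kf′(s))(p cf(s) − q df(s))`. [ours] -/
def Scoll (y : E3) : ℝ :=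
  -4 * Vz (y 2) * dVz (y 2) * ((kf (rs y) + 2 * rs y * deriv kf (rs y)) * (pc y * cf (rs y) - qc y * df (rs y)))

/-- `0 ≤ s`. [ours, bookkeeping] -/
theorem rs_nonneg (y : E3) : 0 ≤ rs y := by unfold rs; nlinarith [sq_nonneg (pc y), sq_nonneg (qc y)]

/-! ## The vorticity square and the stretching in closed form -/

/-- **`|ω|² = A0 + 2X1 + X2` in the core `s ≤ 3/16`.** [ours] -/
theorem vortSq_eq_core (ξ : UnitAddTorus (Fin 3)) (h : rs (repr ξ) ≤ 3 / 16) :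
    torusVorticitySqAt sfld ξ = A0 (repr ξ) + 2 * X1 (repr ξ) + X2 (repr ξ) := by
  obtain ⟨h1, h0⟩ := core_of_le h
  simp only [torusVorticitySqAt, Fin.sum_univ_three, partialDeriv_sfld]
  simp only [jacs, Matrix.of_apply, Matrix.cons_val', Matrix.cons_val_zero, Matrix.cons_val_one,
    Matrix.cons_val_two, Matrix.head_cons, Matrix.tail_cons, Matrix.empty_val',
    Matrix.cons_val_fin_one, Matrix.head_fin_const, A0, X1, X2]
  rw [h1, h0]
  simp only [rs]
  ring

/-- **`σ = S1` everywhere** (in the core by the rotation structure; outside it the jet gradient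
vanishes and the cut-off swirl does not stretch). [ours] -/
theorem stretching_eq (ξ : UnitAddTorus (Fin 3)) :
    torusStretchingDensity sfld ξ = S1 (repr ξ) := by
  simp only [torusStretchingDensity, torusVorticityTensor, Fin.sum_univ_three, partialDeriv_sfld]
  simp only [jacs, Matrix.of_apply, Matrix.cons_val', Matrix.cons_val_zero, Matrix.cons_val_one,
    Matrix.cons_val_two, Matrix.head_cons, Matrix.tail_cons, Matrix.empty_val',
    Matrix.cons_val_fin_one, Matrix.head_fin_const, S1]
  rcases le_or_gt (rs (repr ξ)) (3 / 16) with h | h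
  · obtain ⟨h1, h0⟩ := core_of_le h
    rw [h1, h0]; ring
  · obtain ⟨hx, hy⟩ := jet_of_lt h
    rw [hx, hy]; ring

/-- **The weighted stretching density**: `(|ω|²)^r σ = (A0 + 2X1 + X2)^r · S1` at every point of
the torus, for every real `r`. [ours] -/
theorem moment_density_eq (r : ℝ) (ξ : UnitAddTorus (Fin 3)) :
    torusVorticitySqAt sfld ξ ^ r * torusStretchingDensity sfld ξ =
      (A0 (repr ξ) + 2 * X1 (repr ξ) + X2 (repr ξ)) ^ r * S1 (repr ξ) := by
  rw [stretching_eq]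
  rcases le_or_gt (rs (repr ξ)) (3 / 16) with h | h
  · rw [vortSq_eq_core ξ h]
  · obtain ⟨hx, hy⟩ := jet_of_lt h
    simp [S1, hx, hy]

/-! ## Sums of squares and the structure of `X1`, `S1` -/

/-- `A0 + X2 + 2X1 = 4V² + (J2x + qV′)² + (J2y − pV′)²`. [ours] -/
theorem A0_add_X2_add (y : E3) :
    A0 y + X2 y + 2 * X1 y =
      4 * Vz (y 2) ^ 2 + (J2x y + qc y * dVz (y 2)) ^ 2 + (J2y y - pc y * dVz (y 2)) ^ 2 := by
  simp only [A0, X1, X2, rs]; ring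

/-- `A0 + X2 − 2X1 = 4V² + (J2x − qV′)² + (J2y + pV′)²`. [ours] -/
theorem A0_add_X2_sub (y : E3) :
    A0 y + X2 y - 2 * X1 y =
      4 * Vz (y 2) ^ 2 + (J2x y - qc y * dVz (y 2)) ^ 2 + (J2y y + pc y * dVz (y 2)) ^ 2 := by
  simp only [A0, X1, X2, rs]; ring

/-- `0 ≤ A0 + X2 + 2X1`. [ours] -/
theorem base_plus_nonneg (y : E3) : 0 ≤ A0 y + X2 y + 2 * X1 y := by
  rw [A0_add_X2_add]; positivity

/-- `0 ≤ A0 + X2 − 2X1`. [ours] -/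
theorem base_minus_nonneg (y : E3) : 0 ≤ A0 y + X2 y - 2 * X1 y := by
  rw [A0_add_X2_sub]; positivity

/-- **`X1 = V′ · kf(s) · (p df(s) + q cf(s))`** (only the twist-transverse component of the jet
gradient survives in the cross term). [ours] -/
theorem X1_eq (y : E3) : X1 y = dVz (y 2) * kf (rs y) * (pc y * df (rs y) + qc y * cf (rs y)) := by
  simp only [X1, J2x, J2y]; ring

/-- **`S1 = Scoll + 8 V s ψf′(s) · X1`** (`p J2x + q J2y = (kf + 2s kf′)(p cf − q df) − 2 s kf ψf′ (p df + q cf)`).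
[ours] -/
theorem S1_eq (y : E3) : S1 y = Scoll y + 8 * Vz (y 2) * rs y * deriv ψf (rs y) * X1 y := by
  simp only [S1, Scoll, X1, J2x, J2y, rs]; ring

/-- `Scoll = 0` wherever `Bf′(s) = 0` (radial identity `kf + 2s kf′ = 2√s Bf′`). [ours] -/
theorem Scoll_eq_zero {y : E3} (h : deriv Bf (rs y) = 0) : Scoll y = 0 := by
  simp only [Scoll, kf_add_two_mul_deriv, h, mul_zero, zero_mul]

/-! ## The coordinate reflections of the torus and their effect on cube coordinates -/

/-- Negate the `k`-th angle: `reflT k ξ = (…, −ξₖ, …)` (`y_k ↦ 1 − y_k` in cube coordinates). [ours] -/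
def reflT (k : Fin 3) (ξ : UnitAddTorus (Fin 3)) : UnitAddTorus (Fin 3) :=
  fun i => if i = k then -ξ i else ξ i

/-- `reflT k` is an involution. [ours, bookkeeping] -/
theorem reflT_reflT (k : Fin 3) (ξ : UnitAddTorus (Fin 3)) : reflT k (reflT k ξ) = ξ := by
  funext i; by_cases h : i = k <;> simp [reflT, h]

/-- `reflT k` is continuous. [ours, bookkeeping] -/
theorem continuous_reflT (k : Fin 3) : Continuous (reflT k) := by
  refine continuous_pi fun i => ?_
  by_cases h : i = k
  · simp only [reflT, h, if_true]; exact (continuous_apply k).neg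
  · simp only [reflT, h, if_false]; exact continuous_apply i

/-- `reflT k ξ = proj (negate the k-th cube coordinate of repr ξ)`. [ours, bookkeeping] -/
theorem reflT_eq_proj (k : Fin 3) (ξ : UnitAddTorus (Fin 3)) :
    reflT k ξ = proj (WithLp.toLp 2 fun i => if i = k then -(repr ξ i) else repr ξ i) := by
  have hi : ∀ i, ξ i = ((repr ξ i : ℝ) : UnitAddCircle) := fun i => by
    have h := congrFun (proj_repr ξ).symm i
    rw [h, proj_apply]
  funext i
  rw [proj_apply]
  show (if i = k then -ξ i else ξ i) =
    (((if i = k then -(repr ξ i) else repr ξ i : ℝ)) : UnitAddCircle)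
  by_cases h : i = k
  · rw [if_pos h, if_pos h, AddCircle.coe_neg, hi i]
  · rw [if_neg h, if_neg h, hi i]

/-- Cube coordinates of `reflT k ξ`: `fract(−yₖ)` in slot `k`, `yᵢ` elsewhere. [ours, bookkeeping] -/
theorem repr_reflT_apply (k : Fin 3) (ξ : UnitAddTorus (Fin 3)) (i : Fin 3) :
    repr (reflT k ξ) i = if i = k then Int.fract (-(repr ξ k)) else repr ξ i := by
  rw [reflT_eq_proj, repr_proj_apply]
  show Int.fract (if i = k then -(repr ξ i) else repr ξ i) = _
  by_cases h : i = k
  · subst h; simp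
  · simp only [h, if_false]
    exact Int.fract_eq_self.2 ⟨(repr_apply_mem_Ico ξ i).1, (repr_apply_mem_Ico ξ i).2⟩

/-- `Vz` is even and `1`-periodic: `Vz (fract (−t)) = Vz t`. [folklore] -/
theorem Vz_fract_neg (t : ℝ) : Vz (Int.fract (-t)) = Vz t := by
  unfold Vz
  rw [Int.fract, show 2 * π * (-t - (⌊-t⌋ : ℝ)) = -(2 * π * t) - (⌊-t⌋ : ℤ) * (2 * π) by ring,
    Real.cos_sub_int_mul_two_pi, Real.cos_neg]

/-- `Vz′` is odd and `1`-periodic: `dVz (fract (−t)) = −dVz t`. [folklore] -/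
theorem dVz_fract_neg (t : ℝ) : dVz (Int.fract (-t)) = -dVz t := by
  unfold dVz
  rw [Int.fract, show 2 * π * (-t - (⌊-t⌋ : ℝ)) = -(2 * π * t) - (⌊-t⌋ : ℤ) * (2 * π) by ring,
    Real.sin_sub_int_mul_two_pi, Real.sin_neg]
  ring

/-! ### `reflT 2`: `p, q, s, V` unchanged, `V′` flips -/

/-- Coordinates under `reflT 2`. [ours, bookkeeping] -/
theorem repr_reflT_two (ξ : UnitAddTorus (Fin 3)) :
    pc (repr (reflT 2 ξ)) = pc (repr ξ) ∧ qc (repr (reflT 2 ξ)) = qc (repr ξ) ∧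
      rs (repr (reflT 2 ξ)) = rs (repr ξ) ∧
      Vz (repr (reflT 2 ξ) 2) = Vz (repr ξ 2) ∧ dVz (repr (reflT 2 ξ) 2) = -dVz (repr ξ 2) := by
  have h0 : repr (reflT 2 ξ) 0 = repr ξ 0 := by rw [repr_reflT_apply]; simp
  have h1 : repr (reflT 2 ξ) 1 = repr ξ 1 := by rw [repr_reflT_apply]; simp
  have h2 : repr (reflT 2 ξ) 2 = Int.fract (-(repr ξ 2)) := by rw [repr_reflT_apply]; simp
  have hp : pc (repr (reflT 2 ξ)) = pc (repr ξ) := by simp only [pc, h0]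
  have hq : qc (repr (reflT 2 ξ)) = qc (repr ξ) := by simp only [qc, h1]
  refine ⟨hp, hq, by simp only [rs, hp, hq], by rw [h2, Vz_fract_neg], by rw [h2, dVz_fract_neg]⟩

/-- The jet gradient is blind to `reflT 2`. [ours, bookkeeping] -/
theorem jet_reflT_two (ξ : UnitAddTorus (Fin 3)) :
    J2x (repr (reflT 2 ξ)) = J2x (repr ξ) ∧ J2y (repr (reflT 2 ξ)) = J2y (repr ξ) := by
  obtain ⟨hp, hq, hs, -, -⟩ := repr_reflT_two ξ
  exact ⟨by simp only [J2x, hp, hq, hs], by simp only [J2y, hp, hq, hs]⟩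

/-- **Parities under `reflT 2`: `A0, X2` even, `X1, S1` odd.** [ours] -/
theorem densities_reflT_two (ξ : UnitAddTorus (Fin 3)) :
    A0 (repr (reflT 2 ξ)) = A0 (repr ξ) ∧ X2 (repr (reflT 2 ξ)) = X2 (repr ξ) ∧
      X1 (repr (reflT 2 ξ)) = -X1 (repr ξ) ∧ S1 (repr (reflT 2 ξ)) = -S1 (repr ξ) := by
  obtain ⟨hp, hq, hs, hV, hdV⟩ := repr_reflT_two ξ
  obtain ⟨hx, hy⟩ := jet_reflT_two ξ
  refine ⟨?_, ?_, ?_, ?_⟩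
  · simp only [A0, hs, hV, hdV, neg_sq]
  · simp only [X2, hx, hy]
  · simp only [X1, hp, hq, hdV, hx, hy]; ring
  · simp only [S1, hp, hq, hV, hdV, hx, hy]; ring

/-- **The moment density at the reflected point**:
`(|ω|²)^r σ ∘ reflT 2 = (A0 − 2X1 + X2)^r · (−S1)`. [ours] -/
theorem moment_density_reflT_two (r : ℝ) (ξ : UnitAddTorus (Fin 3)) :
    torusVorticitySqAt sfld (reflT 2 ξ) ^ r * torusStretchingDensity sfld (reflT 2 ξ) =
      (A0 (repr ξ) + X2 (repr ξ) - 2 * X1 (repr ξ)) ^ r * (-S1 (repr ξ)) := by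
  rw [moment_density_eq]
  obtain ⟨hA, hX2, hX1, hS⟩ := densities_reflT_two ξ
  rw [hA, hX2, hX1, hS]
  ring_nf

/-! ### `reflT 0`: `p ↦ −p` off the face; the collar-weighted bracket is odd -/

/-- Coordinates under `reflT 0`: `q`, `y₂`, `s` unchanged; `p ↦ −p` unless `y₀ = 0`, in which case
`p` is unchanged (`= −1/2`) and `s ≥ 1/4`. [ours, bookkeeping] -/
theorem repr_reflT_zero (ξ : UnitAddTorus (Fin 3)) :
    qc (repr (reflT 0 ξ)) = qc (repr ξ) ∧ repr (reflT 0 ξ) 2 = repr ξ 2 ∧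
      rs (repr (reflT 0 ξ)) = rs (repr ξ) ∧
      (pc (repr (reflT 0 ξ)) = -pc (repr ξ) ∨ (pc (repr (reflT 0 ξ)) = pc (repr ξ) ∧ 1 / 4 ≤ rs (repr ξ))) := by
  have h0 : repr (reflT 0 ξ) 0 = Int.fract (-(repr ξ 0)) := by rw [repr_reflT_apply]; simp
  have h1 : repr (reflT 0 ξ) 1 = repr ξ 1 := by rw [repr_reflT_apply]; simp
  have h2 : repr (reflT 0 ξ) 2 = repr ξ 2 := by rw [repr_reflT_apply]; simp
  have hq : qc (repr (reflT 0 ξ)) = qc (repr ξ) := by simp only [qc, h1]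
  have hy0 := repr_apply_mem_Ico ξ 0
  have hpc : pc (repr (reflT 0 ξ)) = -pc (repr ξ) ∨
      (pc (repr (reflT 0 ξ)) = pc (repr ξ) ∧ 1 / 4 ≤ rs (repr ξ)) := by
    by_cases hz : Int.fract (repr ξ 0) = 0
    · right
      have hy : repr ξ 0 = 0 := by
        have := Int.fract_eq_self.2 ⟨hy0.1, hy0.2⟩
        rw [← this]; exact hz
      refine ⟨by simp only [pc, sh, h0, hy, neg_zero, Int.fract_zero], ?_⟩
      unfold rs pc sh
      rw [hy]; nlinarith [sq_nonneg (qc (repr ξ))]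
    · left
      simp only [pc, sh, h0, Int.fract_neg hz, Int.fract_eq_self.2 ⟨hy0.1, hy0.2⟩]
      ring
  refine ⟨hq, h2, ?_, hpc⟩
  rcases hpc with h | ⟨h, -⟩
  · simp only [rs, hq, h]; ring
  · simp only [rs, hq, h]

/-- **Oddness of the collar-weighted bracket under `reflT 0`.** For every real `r`, with
`B± = A0 + X2 ± 2X1`: `((B+)^r − (B−)^r)·Scoll` changes sign under `reflT 0`
(where `Bf′(s) ≠ 0` the twist is locked — `df = 0`, `ψf′ = 0` — so `p ↦ −p` makes `J2x, X1, X2, A0`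
even and `J2y, Scoll` odd; where `Bf′(s) = 0`, `Scoll = 0` on both sides). [ours] -/
theorem Gcoll_reflT_zero (r : ℝ) (ξ : UnitAddTorus (Fin 3)) :
    ((A0 (repr (reflT 0 ξ)) + X2 (repr (reflT 0 ξ)) + 2 * X1 (repr (reflT 0 ξ))) ^ r -
        (A0 (repr (reflT 0 ξ)) + X2 (repr (reflT 0 ξ)) - 2 * X1 (repr (reflT 0 ξ))) ^ r) *
        Scoll (repr (reflT 0 ξ)) =
      -(((A0 (repr ξ) + X2 (repr ξ) + 2 * X1 (repr ξ)) ^ r -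
          (A0 (repr ξ) + X2 (repr ξ) - 2 * X1 (repr ξ)) ^ r) * Scoll (repr ξ)) := by
  obtain ⟨hq, h2, hs, hpc⟩ := repr_reflT_zero ξ
  set y' := repr (reflT 0 ξ) with hy'
  set y := repr ξ with hy
  by_cases hB : deriv Bf (rs y) = 0
  · -- `Bf′(s) = 0` on both sides
    have hB' : deriv Bf (rs y') = 0 := by rw [hs]; exact hB
    rw [Scoll_eq_zero hB, Scoll_eq_zero hB']; ring
  · -- `Bf′(s) ≠ 0`: the twist is locked and the point is off the face, so `p ↦ −p`
    obtain ⟨hd, hψ, -⟩ := (dichotomy (rs y)).resolve_left hB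
    have hp : pc y' = -pc y := by
      rcases hpc with hp | ⟨-, hbig⟩
      · exact hp
      · exact absurd (dBf_eq_zero_of_out (by rw [abs_of_nonneg (by linarith)]; linarith)) hB
    have hx : J2x y' = J2x y := by
      simp only [J2x, hp, hq, hs, hd, hψ]; ring
    have hyy : J2y y' = -J2y y := by
      simp only [J2y, hp, hq, hs, hd, hψ]; ring
    have hA : A0 y' = A0 y := by simp only [A0, hs, h2]
    have hX2 : X2 y' = X2 y := by simp only [X2, hx, hyy, neg_sq]
    have hX1 : X1 y' = X1 y := by
      rw [X1_eq, X1_eq, h2, hs, hp, hq, hd]; ring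
    have hS : Scoll y' = -Scoll y := by
      simp only [Scoll, h2, hs, hp, hq, hd]; ring
    rw [hA, hX2, hX1, hS]; ring

end SpiralJet

end Summit.NavierStokesRegularity.FunctionalMining

end
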